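import Summits.ValiantsHypothesis.ValiantsHypothesis.Theorems.KPlusLogSqLawTridiagonalRealStaticWronskianLinksGauge
import Summits.ValiantsHypothesis.ValiantsHypothesis.Theorems.KPlusLogSqLawTridiagonalRealStaticRootGap

/-!
# Route «KPlusLogSqLaw», crux `WeakLifting` (stmt-ValiantsHypothesis-19561) — REAL side of the tridiagonal sector:
# the TYPE-ALTERNATION ROW — `Z(D_{k+1}) ≤ Z(D_k) + 1 + #{type alternations}` — and the ONE-TYPE INTERLACING LAW (all sizes, intrinsic)

HONEST FRAMING.  Helper (`--supports stmt-ValiantsHypothesis-19561 --as helper`), seat val-sym-lift-p2 (g16), cell `pub-symmetroid`,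
2026-08-28; α register (static symmetric tridiagonal row `B m`), UPPER / structure side.  The sharp, gauge-free form of val-sym-lift-p2 g15's
ROOT-GAP REDUCTION (`…RootGapCount.card_posRoots_le_of_gaugedWronskian`: `#posRoots(D_{k+1}) ≤ 2·#(zeros of D_k·Ω_G) + 1`, and the remark «with
simple roots the sharper `Z(D_{k+1}) ≤ 1 + Z(D_k) + Z(Ω_G ∖ roots)` holds by the same gap argument (not typed)»).  Here the third term is replaced by
the INTRINSIC statistic it bounds: the number of TYPE ALTERNATIONS along the positive root sequence.  The desk's α target (a linear all-designs law)
is NOT proved; α stays NO MOVER.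

TERMS.  For a pair of real polynomials `(P, Q)` (the register uses `P = D_{k+1}`, `Q = D_k`) the TYPE WEIGHT of a point `x` is `w(x) := P′(x)·Q(x)`;
for the continuants of an irreducible static definite symmetric tridiagonal design the SIGN of `w` at a positive root of `D_{k+1}` is the root's TYPE
(creation `w < 0` / annihilation `w > 0` in the Sturm particle picture — p633021 `x_mul_derivative_mul_eval_of_root'`: `x·w(x)` is the signed sum of
squares `Σ_j a_j ε_j x^{d_j} Π_j D_j(x)²`, ε the virtual vertex exponents).  Two CONSECUTIVE positive roots `a < a'` of `P` (none strictly between) are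
a TYPE ALTERNATION of the pair if `w(a)·w(a') ≤ 0` (different types, or a multiple root, or a common root with `Q`); `Alt(P, Q)` = the set of positive
roots `a` of `P` whose successor `a'` exists and forms a type alternation with `a` (written out as a `Finset.filter`, no definition introduced).

* `exists_root_between_of_sameType` (any real `P`, `Q`): consecutive roots `x₁ < x₂` of `P` with `w(x₁)·w(x₂) > 0` enclose a root of `Q` STRICTLY
  between them (`P′` alternates weakly at consecutive roots — g15's `derivative_eval_mul_nonpos_of_consecutive_roots` — so `Q` changes sign).
* `card_le_card_add_one_add_card_alt` (finite combinatorics on `ℝ`): if every same-type consecutive pair of `A` strictly encloses an element of `B`,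
  then `#A ≤ #B + 1 + #Alt`.
* **`card_posRoots_le_typeAlternation` (TYPE-ALTERNATION ROW, any real `P`, `Q`)**: `#posRoots(P) ≤ #posRoots(Q) + 1 + #Alt(P, Q)`;
  **`card_posRoots_pathDet_succ_le_typeAlternation`**: the same for `(D_{k+1}, D_k)` of EVERY static symmetric tridiagonal design (all sizes, no positivity,
  no irreducibility, no simplicity assumed).
* **`card_posRoots_pathDet_succ_le_of_oneType` (ONE-TYPE INTERLACING LAW)**: if `D_{k+1}′(x)·D_k(x)` has one strict sign at every positive root `x` of
  `D_{k+1}`, then `Z(D_{k+1}) ≤ Z(D_k) + 1`; `card_posRoots_pathDet_succ_le_of_cone` — on g15's gauge cone (`G_j ≤ d_j` for `j ≤ k`, `G_0 < d_0`,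
  `0 < a`, `b ≠ 0`) this hypothesis holds (`derivative_mul_prev_pos_of_cone'`), so `Z(D_{k+1}) ≤ Z(D_k) + 1` there (the cone's sharper `⌊m/2⌋` is
  `…StaticTridiagonalGaugeCone`, this seat; the point here is the gauge-free mechanism).
READING (located, seat memos ROOT-TYPE-CALCULUS-liftp2g15 §4 / this seat): telescoping gives `Z(D_m) ≤ (m − 1) + Σ_k #Alt_k`-type budgets; on the register's
breathing extremal designs the row is TIGHT with `Z(D_{m−1})` tiny and EVERY consecutive pair alternating (`B 5 = 7`: `Z(D_4) = 0`, `#Alt = 6`), so the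
α law `B m ≤ 2m − 3` is equivalent there to «at most `2m − 4 − Z(D_{m−1})` type alternations» — the object to bound is the alternation count, for which
this file gives the exact bookkeeping and no bound.  Nothing here bears on `WeakLifting` / `TropicalB` (stmt-19771) in their windows, on Conjecture B, on the
Door-A registers, on `MatrixDescartes` (stmt-ValiantsHypothesis-18050) or on VP ≠ VNP.
[folklore: Rolle-type gap counting; the type bookkeeping is this seat's]
-/

set_option linter.dupNamespace false
set_option autoImplicit false

namespace Summit.ValiantsHypothesis.ValiantsHypothesis.Theorems.KPlusLogSqLaw

namespace StaticTridiagonalRealPotential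

open Polynomial Finset
open scoped Classical

/-! ## 1. Same-type consecutive roots enclose a root of the partner -/

/-- **Same-type consecutive roots of `P` enclose a root of `Q`.**  If `x₁ < x₂` are roots of `P` with no root of `P` strictly between, and the type
weights `P′(x₁)Q(x₁)`, `P′(x₂)Q(x₂)` have the same strict sign, then `Q` vanishes strictly between `x₁` and `x₂`. [folklore: Rolle / intermediate values] -/
theorem exists_root_between_of_sameType (P Q : ℝ[X]) {x₁ x₂ : ℝ} (hlt : x₁ < x₂)
    (h₁ : P.eval x₁ = 0) (h₂ : P.eval x₂ = 0) (hno : ∀ y, x₁ < y → y < x₂ → P.eval y ≠ 0)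
    (hsame : 0 < ((derivative P).eval x₁ * Q.eval x₁) * ((derivative P).eval x₂ * Q.eval x₂)) :
    ∃ y, x₁ < y ∧ y < x₂ ∧ Q.eval y = 0 := by
  have hder := derivative_eval_mul_nonpos_of_consecutive_roots P hlt h₁ h₂ hno
  -- the product of the two `Q`-values is negative
  have hQneg : Q.eval x₁ * Q.eval x₂ < 0 := by
    have e : ((derivative P).eval x₁ * Q.eval x₁) * ((derivative P).eval x₂ * Q.eval x₂) =
        ((derivative P).eval x₁ * (derivative P).eval x₂) * (Q.eval x₁ * Q.eval x₂) := by ring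
    rw [e] at hsame
    rcases lt_trichotomy (Q.eval x₁ * Q.eval x₂) 0 with h | h | h
    · exact h
    · rw [h, mul_zero] at hsame; exact absurd hsame (lt_irrefl 0)
    · exfalso
      have : (derivative P).eval x₁ * (derivative P).eval x₂ * (Q.eval x₁ * Q.eval x₂) ≤ 0 := mul_nonpos_of_nonpos_of_nonneg hder h.le
      linarith
  -- so `Q` has a root on `[x₁, x₂]`, which is not an endpoint
  by_contra hcon
  have hno' : ∀ y, x₁ ≤ y → y ≤ x₂ → Q.eval y ≠ 0 := by
    intro y hy₁ hy₂
    rcases eq_or_lt_of_le hy₁ with rfl | hlt₁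
    · intro h0; rw [h0, zero_mul] at hQneg; exact lt_irrefl 0 hQneg
    rcases eq_or_lt_of_le hy₂ with rfl | hlt₂
    · intro h0; rw [h0, mul_zero] at hQneg; exact lt_irrefl 0 hQneg
    exact fun h0 => hcon ⟨y, hlt₁, hlt₂, h0⟩
  have hpos := eval_mul_eval_pos_of_noRoot_Icc Q hlt.le hno'
  linarith

/-! ## 2. Gap counting with exceptional gaps -/

/-- **Gap counting with exceptions.**  `A, B ⊂ ℝ` finite, `w : ℝ → ℝ`.  Call a consecutive pair `a < a'` of `A` (no element of `A` strictly between) SAME-TYPE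
if `w(a)·w(a') > 0`.  If every same-type consecutive pair strictly encloses an element of `B`, then
`#A ≤ #B + 1 + #{a ∈ A : the successor a' of a in A exists and w(a)·w(a') ≤ 0}`. [folklore] -/
theorem card_le_card_add_one_add_card_alt (w : ℝ → ℝ) : ∀ (n : ℕ) (A B : Finset ℝ), A.card = n →
    (∀ a ∈ A, ∀ a' ∈ A, a < a' → (∀ z ∈ A, ¬ (a < z ∧ z < a')) → 0 < w a * w a' → ∃ b ∈ B, a < b ∧ b < a') →
    A.card ≤ B.card + 1 +
      (A.filter (fun a => ∃ a' ∈ A, a < a' ∧ (∀ z ∈ A, ¬ (a < z ∧ z < a')) ∧ w a * w a' ≤ 0)).card := by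
  intro n
  induction n using Nat.strong_induction_on with
  | _ n ih =>
    intro A B hn hgap
    by_cases hA : A.card ≤ 1
    · omega
    · have hne : A.Nonempty := Finset.card_pos.mp (by omega)
      set a₀ := A.min' hne with ha₀
      have ha₀mem : a₀ ∈ A := Finset.min'_mem A hne
      set A₁ := A.erase a₀ with hA₁
      have hA₁card : A₁.card = A.card - 1 := Finset.card_erase_of_mem ha₀mem
      have hne₁ : A₁.Nonempty := Finset.card_pos.mp (by omega)
      set a₁ := A₁.min' hne₁ with ha₁
      have ha₁mem₁ : a₁ ∈ A₁ := Finset.min'_mem A₁ hne₁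
      have ha₁mem : a₁ ∈ A := Finset.mem_of_mem_erase ha₁mem₁
      have ha₁ne : a₁ ≠ a₀ := Finset.ne_of_mem_erase ha₁mem₁
      have hlt : a₀ < a₁ := lt_of_le_of_ne (Finset.min'_le A a₁ ha₁mem) ha₁ne.symm
      have hge : ∀ z ∈ A, z ≠ a₀ → a₁ ≤ z := fun z hz hz0 => Finset.min'_le A₁ z (Finset.mem_erase.mpr ⟨hz0, hz⟩)
      have hge₁ : ∀ z ∈ A₁, a₁ ≤ z := fun z hz => Finset.min'_le A₁ z hz
      -- `a₀ < a₁` are consecutive in `A`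
      have hcons : ∀ z ∈ A, ¬ (a₀ < z ∧ z < a₁) := by
        intro z hz ⟨h1, h2⟩
        exact absurd (hge z hz (ne_of_gt h1)) (not_le.mpr h2)
      -- consecutive pairs of `A₁` are consecutive pairs of `A`
      have hconsA : ∀ a ∈ A₁, ∀ a' : ℝ, (∀ z ∈ A₁, ¬ (a < z ∧ z < a')) → ∀ z ∈ A, ¬ (a < z ∧ z < a') := by
        intro a ha a' hz z hzA ⟨h1, h2⟩
        by_cases hz0 : z = a₀
        · subst hz0
          exact absurd (lt_of_lt_of_le hlt (hge₁ a ha)) (not_lt.mpr h1.le)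
        · exact hz z (Finset.mem_erase.mpr ⟨hz0, hzA⟩) ⟨h1, h2⟩
      -- the exceptional set of `A₁` sits inside that of `A`
      set Alt : Finset ℝ := A.filter (fun a => ∃ a' ∈ A, a < a' ∧ (∀ z ∈ A, ¬ (a < z ∧ z < a')) ∧ w a * w a' ≤ 0) with hAlt
      set Alt₁ : Finset ℝ := A₁.filter (fun a => ∃ a' ∈ A₁, a < a' ∧ (∀ z ∈ A₁, ¬ (a < z ∧ z < a')) ∧ w a * w a' ≤ 0) with hAlt₁
      have hsub : Alt₁ ⊆ Alt.erase a₀ := by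
        intro a ha
        rw [hAlt₁, Finset.mem_filter] at ha
        obtain ⟨haA₁, a', ha'A₁, haa', hz, hw⟩ := ha
        refine Finset.mem_erase.mpr ⟨Finset.ne_of_mem_erase haA₁, Finset.mem_filter.mpr ⟨Finset.mem_of_mem_erase haA₁, a',
          Finset.mem_of_mem_erase ha'A₁, haa', hconsA a haA₁ a' hz, hw⟩⟩
      have hAlt₁_le : Alt₁.card + (if w a₀ * w a₁ ≤ 0 then 1 else 0) ≤ Alt.card := by
        split_ifs with hw
        · have ha₀Alt : a₀ ∈ Alt := Finset.mem_filter.mpr ⟨ha₀mem, a₁, ha₁mem, hlt, hcons, hw⟩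
          have := Finset.card_le_card hsub
          rw [Finset.card_erase_of_mem ha₀Alt] at this
          have hpos : 0 < Alt.card := Finset.card_pos.mpr ⟨a₀, ha₀Alt⟩
          omega
        · have := (Finset.card_le_card hsub).trans (Finset.card_erase_le)
          omega
      -- the gap hypothesis for `A₁` with `B` and with `B.erase b`
      have hgap₁ : ∀ B' : Finset ℝ, (∀ b ∈ B, a₁ < b → b ∈ B') →
          ∀ a ∈ A₁, ∀ a' ∈ A₁, a < a' → (∀ z ∈ A₁, ¬ (a < z ∧ z < a')) → 0 < w a * w a' → ∃ b ∈ B', a < b ∧ b < a' := by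
        intro B' hB' a ha a' ha' haa' hz hw
        obtain ⟨b, hb, hab, hba'⟩ := hgap a (Finset.mem_of_mem_erase ha) a' (Finset.mem_of_mem_erase ha') haa' (hconsA a ha a' hz) hw
        exact ⟨b, hB' b hb (lt_of_le_of_lt (hge₁ a ha) hab), hab, hba'⟩
      by_cases hw : 0 < w a₀ * w a₁
      · -- same type: a `b ∈ B` sits in `(a₀, a₁)`, below every element of `A₁`
        obtain ⟨b, hb, hab, hba⟩ := hgap a₀ ha₀mem a₁ ha₁mem hlt hcons hw
        have hrec := ih (A.card - 1) (by omega) A₁ (B.erase b) hA₁card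
          (hgap₁ (B.erase b) fun b' hb' hlt' => Finset.mem_erase.mpr ⟨ne_of_gt (lt_trans hba hlt'), hb'⟩)
        rw [Finset.card_erase_of_mem hb, ← hAlt₁] at hrec
        have hBpos : 0 < B.card := Finset.card_pos.mpr ⟨b, hb⟩
        have hw' : ¬ (w a₀ * w a₁ ≤ 0) := not_le.mpr hw
        rw [if_neg hw'] at hAlt₁_le
        omega
      · have hrec := ih (A.card - 1) (by omega) A₁ B hA₁card (hgap₁ B fun b' hb' _ => hb')
        rw [← hAlt₁] at hrec
        rw [if_pos (not_lt.mp hw)] at hAlt₁_le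
        omega

/-! ## 3. The type-alternation row for a pair of real polynomials -/

/-- **TYPE-ALTERNATION ROW (any pair of real polynomials).**  With the type weight `w = P′·Q`:
`#posRoots(P) ≤ #posRoots(Q) + 1 + #{positive roots a of P whose successor root a' of P (no root of P strictly between) has w(a)·w(a') ≤ 0}`.
[this file] -/
theorem card_posRoots_le_typeAlternation (P Q : ℝ[X]) :
    (P.roots.toFinset.filter (fun x => 0 < x)).card ≤ (Q.roots.toFinset.filter (fun x => 0 < x)).card + 1 +
      ((P.roots.toFinset.filter (fun x => 0 < x)).filter (fun a => ∃ a' : ℝ, P.eval a' = 0 ∧ a < a' ∧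
        (∀ z : ℝ, P.eval z = 0 → ¬ (a < z ∧ z < a')) ∧
        ((derivative P).eval a * Q.eval a) * ((derivative P).eval a' * Q.eval a') ≤ 0)).card := by
  set A := P.roots.toFinset.filter (fun x => 0 < x) with hA
  set B := Q.roots.toFinset.filter (fun x => 0 < x) with hB
  have hmemA : ∀ x, x ∈ A ↔ P ≠ 0 ∧ P.eval x = 0 ∧ 0 < x := by
    intro x
    rw [hA, Finset.mem_filter, Multiset.mem_toFinset, mem_roots', IsRoot.def]
    tauto
  have hcomb := card_le_card_add_one_add_card_alt (fun x => (derivative P).eval x * Q.eval x) A.card A B rfl ?_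
  · refine hcomb.trans (Nat.add_le_add_left (Finset.card_le_card fun a ha => ?_) _)
    rw [Finset.mem_filter] at ha ⊢
    obtain ⟨haA, a', ha'A, haa', hz, hw⟩ := ha
    obtain ⟨hP, hPa', -⟩ := (hmemA a').mp ha'A
    obtain ⟨-, -, hapos⟩ := (hmemA a).mp haA
    refine ⟨haA, a', hPa', haa', fun z hPz hzz => hz z ((hmemA z).mpr ⟨hP, hPz, lt_trans hapos hzz.1⟩) hzz, hw⟩
  · intro a ha a' ha' haa' hz hw
    obtain ⟨hP, hPa, hapos⟩ := (hmemA a).mp ha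
    obtain ⟨-, hPa', -⟩ := (hmemA a').mp ha'
    have hno : ∀ y, a < y → y < a' → P.eval y ≠ 0 := by
      intro y hy1 hy2 hPy
      exact hz y ((hmemA y).mpr ⟨hP, hPy, lt_trans hapos hy1⟩) ⟨hy1, hy2⟩
    obtain ⟨y, hy1, hy2, hQy⟩ := exists_root_between_of_sameType P Q haa' hPa hPa' hno hw
    have hQ : Q ≠ 0 := by
      rintro rfl
      simp only [eval_zero, mul_zero, lt_self_iff_false] at hw
    refine ⟨y, ?_, hy1, hy2⟩
    rw [hB, Finset.mem_filter, Multiset.mem_toFinset, mem_roots', IsRoot.def]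
    exact ⟨⟨hQ, hQy⟩, lt_trans hapos hy1⟩

/-! ## 4. The register: continuants `(D_{k+1}, D_k)` -/

variable (a : ℕ → ℝ) (d : ℕ → ℕ) (b : ℕ → ℝ) (f : ℕ → ℕ)

/-- **TYPE-ALTERNATION ROW of the α register (all sizes, every static symmetric tridiagonal design).**
`Z(D_{k+1}) ≤ Z(D_k) + 1 + #{type alternations}`, where a type alternation is a positive root `x` of `D_{k+1}` whose successor root `x'` of `D_{k+1}`
(no root strictly between) satisfies `(D_{k+1}′(x)D_k(x))·(D_{k+1}′(x')D_k(x')) ≤ 0` — for an irreducible definite design with simple roots: consecutive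
roots of DIFFERENT TYPE (creation/annihilation). [this file] -/
theorem card_posRoots_pathDet_succ_le_typeAlternation (k : ℕ) :
    ((pathDet a d b f (k + 1)).roots.toFinset.filter (fun x => 0 < x)).card ≤
      ((pathDet a d b f k).roots.toFinset.filter (fun x => 0 < x)).card + 1 +
      (((pathDet a d b f (k + 1)).roots.toFinset.filter (fun x => 0 < x)).filter (fun x =>
        ∃ x' : ℝ, (pathDet a d b f (k + 1)).eval x' = 0 ∧ x < x' ∧
          (∀ z : ℝ, (pathDet a d b f (k + 1)).eval z = 0 → ¬ (x < z ∧ z < x')) ∧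
          ((derivative (pathDet a d b f (k + 1))).eval x * (pathDet a d b f k).eval x) *
            ((derivative (pathDet a d b f (k + 1))).eval x' * (pathDet a d b f k).eval x') ≤ 0)).card :=
  card_posRoots_le_typeAlternation _ _

/-- **ONE-TYPE INTERLACING LAW (all sizes).**  If the type weight `D_{k+1}′(x)·D_k(x)` is POSITIVE at every positive root `x` of `D_{k+1}` (every root an
annihilation, in the orientation `x` increasing), or NEGATIVE at every one (every root a creation), then `Z(D_{k+1}) ≤ Z(D_k) + 1`: the roots of
`D_k` separate those of `D_{k+1}`. [this file] -/
theorem card_posRoots_pathDet_succ_le_of_oneType (k : ℕ)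
    (hone : (∀ x, 0 < x → (pathDet a d b f (k + 1)).eval x = 0 →
        0 < (derivative (pathDet a d b f (k + 1))).eval x * (pathDet a d b f k).eval x) ∨
      (∀ x, 0 < x → (pathDet a d b f (k + 1)).eval x = 0 →
        (derivative (pathDet a d b f (k + 1))).eval x * (pathDet a d b f k).eval x < 0)) :
    ((pathDet a d b f (k + 1)).roots.toFinset.filter (fun x => 0 < x)).card ≤
      ((pathDet a d b f k).roots.toFinset.filter (fun x => 0 < x)).card + 1 := by
  have h := card_posRoots_pathDet_succ_le_typeAlternation a d b f k
  -- the exceptional set is empty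
  have hempty : (((pathDet a d b f (k + 1)).roots.toFinset.filter (fun x => 0 < x)).filter (fun x =>
        ∃ x' : ℝ, (pathDet a d b f (k + 1)).eval x' = 0 ∧ x < x' ∧
          (∀ z : ℝ, (pathDet a d b f (k + 1)).eval z = 0 → ¬ (x < z ∧ z < x')) ∧
          ((derivative (pathDet a d b f (k + 1))).eval x * (pathDet a d b f k).eval x) *
            ((derivative (pathDet a d b f (k + 1))).eval x' * (pathDet a d b f k).eval x') ≤ 0)) = ∅ := by
    refine Finset.filter_eq_empty_iff.mpr ?_
    rintro x hx ⟨x', hx', hxx', -, hw⟩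
    rw [Finset.mem_filter, Multiset.mem_toFinset, mem_roots', IsRoot.def] at hx
    have hx'pos : 0 < x' := lt_trans hx.2 hxx'
    rcases hone with hpos | hneg
    · have := mul_pos (hpos x hx.2 hx.1.2) (hpos x' hx'pos hx')
      linarith
    · have := mul_pos_of_neg_of_neg (hneg x hx.2 hx.1.2) (hneg x' hx'pos hx')
      linarith
  rw [hempty, Finset.card_empty, add_zero] at h
  exact h

/-- **On the gauge cone the roots of consecutive continuants interlace**: for a static DEFINITE design with non-zero links and an alternating
antiderivative `G` of the doubled link exponents with `G_j ≤ d_j` (`j ≤ k`) and `G_0 < d_0` (g15's cone, every root an annihilation by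
`derivative_mul_prev_pos_of_cone'`), `Z(D_{k+1}) ≤ Z(D_k) + 1`.  (The cone's sharp count `⌊m/2⌋` is `…StaticTridiagonalGaugeCone`; this is the gauge-free
interlacing mechanism behind it.) [this file] -/
theorem card_posRoots_pathDet_succ_le_of_cone (G : ℕ → ℤ) (hG : ∀ j, G (j + 1) = 2 * (f j : ℤ) - G j) (k : ℕ)
    (ha : ∀ t, 0 < a t) (hb : ∀ t, b t ≠ 0) (hcone : ∀ j, j ≤ k → (G j : ℝ) ≤ d j) (hstrict : (G 0 : ℝ) < d 0) :
    ((pathDet a d b f (k + 1)).roots.toFinset.filter (fun x => 0 < x)).card ≤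
      ((pathDet a d b f k).roots.toFinset.filter (fun x => 0 < x)).card + 1 :=
  card_posRoots_pathDet_succ_le_of_oneType a d b f k
    (Or.inl fun _ hx hroot => derivative_mul_prev_pos_of_cone' a d b f G hG k ha hb hcone hstrict hx hroot)

end StaticTridiagonalRealPotential

end Summit.ValiantsHypothesis.ValiantsHypothesis.Theorems.KPlusLogSqLaw
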